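import Summits.Ventures.YMGap.FlowData.SecondOrderTailSpectral
import Mathlib.Analysis.Matrix.Spectrum
import Mathlib.Analysis.Matrix.PosDef

/-!
# Venture YMGap, track Y3 FLOW-DATA — the x2r second-order tail bound for a real symmetric MATRIX and a kept predicate

HONEST FRAMING: venture file of the cell `pub-ymgap`, track Y3; the matrix reading of `SecondOrderTailSpectral.x2r_eigenvalue_bound`
(files 1–3 carry the story).  For `M : Matrix m m ℝ` positive semidefinite and a decidable kept predicate `p` (kept projection
`P = diagonal (p ? 1 : 0)`, dropped `D = diagonal (p ? 0 : 1)`), with every hypothesis in coordinates (`dotProduct` / `mulVec`):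
dropped block `yᵀ M y ≤ ε yᵀ y` for `y` vanishing on the kept set, kept block `aᵀ M a ≤ Λ aᵀ a` for `a` vanishing off it, the sorted
eigenvalues `λ↓` of the kept compression `P M P` with `λ↓₁ ≤ ℓ₁`, `λ↓₀ ∈ [μ_lo, μ_up]`, a kept unit vector `v` with `ρ = vᵀ M v > ℓ₁`,
`r = ‖P M v − ρ v‖`, `X^{1/2} = ‖D M v‖`, `γ = εΛ/(ℓ − ε)`, `η = √2 r/(ρ − ℓ₁)`, `0 ≤ ε < ℓ ≤ λ↓₀(M)`, `μ_lo − ℓ₁ − γ > 0`: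
`λ↓₀(M) ≤ μ_up + (X^{1/2} + (εΛ)^{1/2} η)²/(ℓ − ε) · (1 + γ/(μ_lo − ℓ₁ − γ))` for Mathlib's `Matrix.IsHermitian.eigenvalues₀`
— `x2r_eigenvalues₀_bound`.  Pure bookkeeping between `Matrix.toEuclideanLin` and `EuclideanSpace ℝ m`; no number, no row.
References: as in files 1–3 [cite: Saad1992, Ch. III Thm 3.8]; [cite: HornJohnson2013, Thm 7.7.7].
-/

noncomputable section

open scoped InnerProductSpace
open RealInnerProductSpace Module Matrix WithLp

namespace Summit.Ventures.YMGap.FlowData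

namespace SecondOrderTail

variable {m : Type*} [Fintype m] [DecidableEq m]

/-- The kept compression `P M P` of a symmetric real matrix is symmetric. [folklore] -/
theorem isHermitian_keptCompression {M : Matrix m m ℝ} (hM : M.IsHermitian) (p : m → Prop) [DecidablePred p] :
    (diagonal (fun i => if p i then (1 : ℝ) else 0) * M * diagonal (fun i => if p i then (1 : ℝ) else 0)).IsHermitian := by
  have hP : (diagonal (fun i => if p i then (1 : ℝ) else 0)).IsHermitian :=
    isHermitian_diagonal_of_self_adjoint _ (IsSelfAdjoint.all _)
  have h := isHermitian_conjTranspose_mul_mul (diagonal (fun i => if p i then (1 : ℝ) else 0)) hM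
  rwa [hP.eq] at h

/-- Kept/dropped splitting of a coordinate vector: `w − D w = P w`. [folklore] -/
theorem sub_dropped_mulVec (p : m → Prop) [DecidablePred p] (w : m → ℝ) :
    w - diagonal (fun i => if p i then (0 : ℝ) else 1) *ᵥ w = diagonal (fun i => if p i then (1 : ℝ) else 0) *ᵥ w := by
  funext i
  simp only [Pi.sub_apply, mulVec_diagonal]
  by_cases h : p i <;> simp [h]

/-- `D (D w) = D w`. [folklore] -/
theorem dropped_mulVec_idem (p : m → Prop) [DecidablePred p] (w : m → ℝ) :
    diagonal (fun i => if p i then (0 : ℝ) else 1) *ᵥ (diagonal (fun i => if p i then (0 : ℝ) else 1) *ᵥ w) =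
      diagonal (fun i => if p i then (0 : ℝ) else 1) *ᵥ w := by
  funext i
  simp only [mulVec_diagonal]
  by_cases h : p i <;> simp [h]

/-- The real inner product `⟨x, toEuclideanLin A y⟩ = xᵀ A y`. [folklore] -/
theorem inner_toEuclideanLin_right (A : Matrix m m ℝ) (x y : EuclideanSpace ℝ m) :
    ⟪x, Matrix.toEuclideanLin A y⟫ = ofLp x ⬝ᵥ (A *ᵥ ofLp y) := by
  rw [EuclideanSpace.inner_eq_star_dotProduct, star_trivial, dotProduct_comm]
  rfl

omit [DecidableEq m] in
/-- `‖x‖² = xᵀ x` on `EuclideanSpace ℝ m`. [folklore] -/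
theorem norm_sq_eq_dotProduct' (x : EuclideanSpace ℝ m) : ‖x‖ ^ 2 = ofLp x ⬝ᵥ ofLp x := by
  rw [EuclideanSpace.real_norm_sq_eq]
  simp only [dotProduct, pow_two]

/-- **The x2r bound for `λ↓₀` of a positive semidefinite real matrix from a kept set** — see the module docstring;
`SecondOrderTailSpectral.x2r_eigenvalue_bound` with `T = toEuclideanLin M`, `Q = toEuclideanLin D`, `A = toEuclideanLin (P M P)`.
[cite: Saad1992, Ch. III Thm 3.8] -/
theorem x2r_eigenvalues₀_bound {M : Matrix m m ℝ} (hM : M.PosSemidef) (p : m → Prop) [DecidablePred p]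
    (hcard : 1 < Fintype.card m) {ε ℓ Λ ℓ₁ μlo μup ρ r X γ η : ℝ} {v : m → ℝ} (hε : 0 ≤ ε)
    (hD : ∀ y : m → ℝ, (∀ i, p i → y i = 0) → y ⬝ᵥ (M *ᵥ y) ≤ ε * (y ⬝ᵥ y))
    (hεℓ : ε < ℓ) (hℓ : ℓ ≤ hM.1.eigenvalues₀ ⟨0, by omega⟩)
    (hΛ : ∀ a : m → ℝ, (∀ i, ¬ p i → a i = 0) → a ⬝ᵥ (M *ᵥ a) ≤ Λ * (a ⬝ᵥ a)) (hℓ₁0 : 0 ≤ ℓ₁)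
    (hℓ₁ : (isHermitian_keptCompression hM.1 p).eigenvalues₀ ⟨1, hcard⟩ ≤ ℓ₁)
    (hlo : μlo ≤ (isHermitian_keptCompression hM.1 p).eigenvalues₀ ⟨0, by omega⟩)
    (hup : (isHermitian_keptCompression hM.1 p).eigenvalues₀ ⟨0, by omega⟩ ≤ μup)
    (hv : v ⬝ᵥ v = 1) (hvp : ∀ i, ¬ p i → v i = 0) (hρ : ρ = v ⬝ᵥ (M *ᵥ v)) (hρℓ₁ : ℓ₁ < ρ)
    (hr : r = ‖(toLp 2 (diagonal (fun i => if p i then (1 : ℝ) else 0) *ᵥ (M *ᵥ v) - ρ • v) : EuclideanSpace ℝ m)‖)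
    (hX : X = ‖(toLp 2 (diagonal (fun i => if p i then (0 : ℝ) else 1) *ᵥ (M *ᵥ v)) : EuclideanSpace ℝ m)‖)
    (hγ : γ = ε * Λ / (ℓ - ε)) (hη : η = Real.sqrt 2 * r / (ρ - ℓ₁)) (hden : 0 < μlo - ℓ₁ - γ) :
    hM.1.eigenvalues₀ ⟨0, by omega⟩ ≤ μup + (X + Real.sqrt (ε * Λ) * η) ^ 2 / (ℓ - ε) * (1 + γ / (μlo - ℓ₁ - γ)) := by
  set P : Matrix m m ℝ := diagonal (fun i => if p i then (1 : ℝ) else 0) with hPdef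
  set Dm : Matrix m m ℝ := diagonal (fun i => if p i then (0 : ℝ) else 1) with hDdef
  have hDh : Dm.IsHermitian := isHermitian_diagonal_of_self_adjoint _ (IsSelfAdjoint.all _)
  set T := Matrix.toEuclideanLin M with hTdef
  set Q := Matrix.toEuclideanLin Dm with hQdef
  set A := Matrix.toEuclideanLin (P * M * P) with hAdef
  have hT : T.IsSymmetric := Matrix.isSymmetric_toEuclideanLin_iff.mpr hM.1
  have hQs : ∀ x y : EuclideanSpace ℝ m, ⟪Q x, y⟫ = ⟪x, Q y⟫ := Matrix.isSymmetric_toEuclideanLin_iff.mpr hDh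
  have hA : A.IsSymmetric := Matrix.isSymmetric_toEuclideanLin_iff.mpr (isHermitian_keptCompression hM.1 p)
  -- coordinates of T x, Q x, A x
  have hTo : ∀ x : EuclideanSpace ℝ m, ofLp (T x) = M *ᵥ ofLp x := fun x => WithLp.ofLp_toLp 2 _
  have hQo : ∀ x : EuclideanSpace ℝ m, ofLp (Q x) = Dm *ᵥ ofLp x := fun x => WithLp.ofLp_toLp 2 _
  have hAo : ∀ x : EuclideanSpace ℝ m, ofLp (A x) = (P * M * P) *ᵥ ofLp x := fun x => WithLp.ofLp_toLp 2 _
  have hQi : ∀ x : EuclideanSpace ℝ m, Q (Q x) = Q x := by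
    intro x
    apply WithLp.ofLp_injective 2
    rw [hQo, hQo, dropped_mulVec_idem]
  have hsubo : ∀ a : EuclideanSpace ℝ m, ofLp (a - Q a) = P *ᵥ ofLp a := by
    intro a
    rw [WithLp.ofLp_sub, hQo, sub_dropped_mulVec]
  have hAeq : ∀ a : EuclideanSpace ℝ m, A a = T (a - Q a) - Q (T (a - Q a)) := by
    intro a
    apply WithLp.ofLp_injective 2
    rw [hAo, WithLp.ofLp_sub, hQo, hTo, hsubo, sub_dropped_mulVec, ← mulVec_mulVec, ← mulVec_mulVec]
  have hpos : ∀ z : EuclideanSpace ℝ m, 0 ≤ ⟪z, T z⟫ := by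
    intro z
    rw [inner_toEuclideanLin_right]
    have h := hM.dotProduct_mulVec_nonneg (ofLp z)
    rwa [star_trivial] at h
  have hD' : ∀ y : EuclideanSpace ℝ m, ⟪Q y, T (Q y)⟫ ≤ ε * ‖Q y‖ ^ 2 := by
    intro y
    rw [inner_toEuclideanLin_right, norm_sq_eq_dotProduct', hQo]
    refine hD _ fun i hi => ?_
    simp [hDdef, mulVec_diagonal, hi]
  have hΛ' : ∀ a : EuclideanSpace ℝ m, Q a = 0 → ⟪a, T a⟫ ≤ Λ * ‖a‖ ^ 2 := by
    intro a ha
    rw [inner_toEuclideanLin_right, norm_sq_eq_dotProduct']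
    refine hΛ _ fun i hi => ?_
    have h1 : (Dm *ᵥ ofLp a) i = 0 := by
      rw [← hQo, ha, WithLp.ofLp_zero]
      rfl
    simpa [hDdef, mulVec_diagonal, hi] using h1
  have hv' : ‖(toLp 2 v : EuclideanSpace ℝ m)‖ = 1 := by
    have h := norm_sq_eq_dotProduct' (toLp 2 v : EuclideanSpace ℝ m)
    rw [WithLp.ofLp_toLp, hv] at h
    exact (pow_eq_one_iff_of_nonneg (norm_nonneg _) two_ne_zero).mp h
  have hQv : Q (toLp 2 v) = 0 := by
    apply WithLp.ofLp_injective 2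
    rw [hQo, WithLp.ofLp_toLp, WithLp.ofLp_zero]
    funext i
    simp only [hDdef, mulVec_diagonal, Pi.zero_apply]
    by_cases h : p i
    · simp [h]
    · simp [h, hvp i h]
  have hρ' : ρ = ⟪(toLp 2 v : EuclideanSpace ℝ m), T (toLp 2 v)⟫ := by
    rw [inner_toEuclideanLin_right, WithLp.ofLp_toLp, hρ]
  have hres : T (toLp 2 v) - Q (T (toLp 2 v)) - ρ • (toLp 2 v : EuclideanSpace ℝ m) =
      toLp 2 (P *ᵥ (M *ᵥ v) - ρ • v) := by
    apply WithLp.ofLp_injective 2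
    rw [WithLp.ofLp_sub, WithLp.ofLp_sub, WithLp.ofLp_smul, hQo, hTo, WithLp.ofLp_toLp, WithLp.ofLp_toLp,
      sub_dropped_mulVec]
  have hr' : r = ‖T (toLp 2 v) - Q (T (toLp 2 v)) - ρ • (toLp 2 v : EuclideanSpace ℝ m)‖ := by
    rw [hres]; exact hr
  have hlea : Q (T (toLp 2 v)) = toLp 2 (Dm *ᵥ (M *ᵥ v)) := by
    apply WithLp.ofLp_injective 2
    rw [hQo, hTo, WithLp.ofLp_toLp, WithLp.ofLp_toLp]
  have hX' : X = ‖Q (T (toLp 2 v))‖ := by rw [hlea]; exact hX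
  exact x2r_eigenvalue_bound finrank_euclideanSpace hcard hT hpos hQs hQi hA hAeq hε hD' hεℓ hℓ hΛ' hℓ₁0 hℓ₁ hlo hup hv'
    hQv (v := toLp 2 v) hρ' hρℓ₁ hr' hX' hγ hη hden

end SecondOrderTail

end Summit.Ventures.YMGap.FlowData
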